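import Literature.Analysis.FluidPDE.PassiveVectorGalerkinLimitBounds
import Summits.AnomalousDissipation.AnomalousDissipation.Theorems.SolenoidalFractalHomogenisationRealisedQuasiStaticCellLawCellLadder
import HarnessLib

/-!
# K2R `RealisedQuasiStaticCellLaw`, line `floquet-bloch`: transfer of Galerkin-level energy bounds to every weak solution
# (helper towards the registered stubs `stub_lowSectorDecay` / `stub_upperSome`; `--supports stmt-AnomalousDissipation-20446`)

Summits-side helper file (everything proved; no definitions, no named facts). The Bloch-sector analysis of the crux
(STUB-PLAN `stub_lowSectorDecay`, §4.5 «which solution») is carried out on the Galerkin truncations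
`(pvSetup_cell …).galerkinCoeff N` of the cell problem, uniformly in `N`. This file turns such uniform estimates into the
statements the stubs ask for:

* `ae_integral_norm_sq_le_of_galerkinBound`: an upper bound `∑_k ‖α_N(t) k‖² ≤ Φ t` (`t ≥ 0`, eventually in `N`) holds
  for EVERY weak `A = 0` solution around the cell from the same datum, `∫‖w t‖² ≤ Φ t` for a.e. `t ∈ (0,T)` — Galerkin limit
  (`PVSetup.exists_isGalerkinLimit`, `IsGalerkinLimit.integral_norm_sq_le_of_eventually_galerkin_le`), which is a weak
  solution (`IsGalerkinLimit.isWeakPassiveVectorOn`), and uniqueness in the weak class (`stub_cellUnique`);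
* `exists_weak_of_galerkinLowerBound`: a lower bound `Ψ t ≤ ∑_{k∈G} ‖α_N(t)(k)‖²` on finitely many modes (eventually in
  `N`) yields a weak solution with `Ψ t ≤ ∫‖w t‖²` for a.e. `t ∈ (0,T)` (the Galerkin limit itself).
-/

set_option linter.dupNamespace false

noncomputable section

namespace Summit.AnomalousDissipation.AnomalousDissipation.Theorems.SolenoidalFractalHomogenisation.RealisedQuasiStaticCellLaw

open Set MeasureTheory Filter Topology Function
open scoped InnerProductSpace
open Literature.Analysis Literature.Analysis.FunctionSpaces Literature.Analysis.FunctionSpaces.Torus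
open Literature.Analysis.FluidPDE Literature.Analysis.FluidPDE.LatticeShear

variable {k₀ : ℕ}

/-- **Galerkin upper bounds hold for every weak solution.** For a lattice word `W`, `n ≥ 1`, `κ > 0`, a Bloch sector
`±ℓ + nℤ³` and an `H¹` weakly divergence-free mean-zero datum supported in the sector: if the coefficient energies of the
Galerkin truncations of the cell problem satisfy `∑_k ‖α_N(t) k‖² ≤ Φ t` for every `t ≥ 0`, eventually in `N`, then EVERY
weak solution `w` of the passive solenoidal vector equation around `W.cell n` from that datum on `(0,T)` satisfies
`∫‖w t‖² ≤ Φ t` for a.e. `t ∈ (0,T)`. -/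
theorem ae_integral_norm_sq_le_of_galerkinBound (W : LatticeWord k₀) {n : ℕ} (hn : 0 < n) {κ : ℝ} (hκ : 0 < κ)
    (ℓ : Fin 3 → ℤ) {w₀ : UnitAddTorus (Fin 3) → EuclideanSpace ℝ (Fin 3)}
    (hw₀ : FunctionSpaces.Torus.MemSobolev 1 (FunctionSpaces.EuclideanSpace.complexify ∘ w₀))
    (hdiv : FunctionSpaces.Torus.IsWeaklyDivFree w₀) (hmean : FunctionSpaces.Torus.HasZeroMean w₀)
    (hsupp : ∀ k : Fin 3 → ℤ, ¬ ((∃ z : Fin 3 → ℤ, k = ℓ + (n:ℤ) • z) ∨ (∃ z : Fin 3 → ℤ, k = -ℓ + (n:ℤ) • z)) →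
      UnitAddTorus.mFourierCoeff (FunctionSpaces.EuclideanSpace.complexify ∘ w₀) k = 0)
    {Φ : ℝ → ℝ} (hΦ : ∀ᶠ N in atTop, ∀ t, 0 ≤ t →
      ∑ k, ‖(pvSetup_cell W hn hκ.le ℓ hw₀ hdiv hmean hsupp).galerkinCoeff N t k‖ ^ 2 ≤ Φ t)
    {T : ℝ} (hT : 0 < T) {w : ℝ → UnitAddTorus (Fin 3) → EuclideanSpace ℝ (Fin 3)}
    (hw : Torus.IsWeakPassiveVectorOn 0 T κ (W.cell n) w₀ w) :
    ∀ᵐ t ∂(volume.restrict (Ioo 0 T)), ∫ x, ‖w t x‖ ^ 2 ≤ Φ t := by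
  set hPV := pvSetup_cell W hn hκ.le ℓ hw₀ hdiv hmean hsupp with hPVdef
  obtain ⟨φ, c, w', hl⟩ := hPV.exists_isGalerkinLimit
  have hbd : ∀ t, 0 ≤ t → ∫ x, ‖w' t x‖ ^ 2 ≤ Φ t := fun t ht =>
    hl.integral_norm_sq_le_of_eventually_galerkin_le ht
      ((hl.strictMono.tendsto_atTop.eventually hΦ).mono fun N hN => hN t ht)
  have hw' : Torus.IsWeakPassiveVectorOn 0 T κ (W.cell n) w₀ w' := hl.isWeakPassiveVectorOn hT
  have hae := stub_cellUnique k₀ W n κ T hκ w₀ w w' hw hw'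
  filter_upwards [Torus.ae_integral_norm_sq_congr hae, ae_restrict_mem measurableSet_Ioo] with t ht htI
  rw [ht]
  exact hbd t htI.1.le

/-- **Galerkin lower bounds on finitely many modes are realised by a weak solution.** Under the same hypotheses, if
for a finite set of modes `G` the Galerkin truncations satisfy `Ψ t ≤ ∑_{k∈G} ‖α_N(t)(k)‖²` for every `t ≥ 0`, eventually
in `N`, then for every `T > 0` there is a weak solution `w` around `W.cell n` from the datum with `Ψ t ≤ ∫‖w t‖²` for
a.e. `t ∈ (0,T)` (the Galerkin limit). -/
theorem exists_weak_of_galerkinLowerBound (W : LatticeWord k₀) {n : ℕ} (hn : 0 < n) {κ : ℝ} (hκ : 0 < κ)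
    (ℓ : Fin 3 → ℤ) {w₀ : UnitAddTorus (Fin 3) → EuclideanSpace ℝ (Fin 3)}
    (hw₀ : FunctionSpaces.Torus.MemSobolev 1 (FunctionSpaces.EuclideanSpace.complexify ∘ w₀))
    (hdiv : FunctionSpaces.Torus.IsWeaklyDivFree w₀) (hmean : FunctionSpaces.Torus.HasZeroMean w₀)
    (hsupp : ∀ k : Fin 3 → ℤ, ¬ ((∃ z : Fin 3 → ℤ, k = ℓ + (n:ℤ) • z) ∨ (∃ z : Fin 3 → ℤ, k = -ℓ + (n:ℤ) • z)) →
      UnitAddTorus.mFourierCoeff (FunctionSpaces.EuclideanSpace.complexify ∘ w₀) k = 0)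
    (G : Finset (Fin 3 → ℤ)) {Ψ : ℝ → ℝ} (hΨ : ∀ᶠ N in atTop, ∀ t, 0 ≤ t →
      Ψ t ≤ ∑ k ∈ G, ‖(pvSetup_cell W hn hκ.le ℓ hw₀ hdiv hmean hsupp).galerkinCoeffAt N t k‖ ^ 2)
    {T : ℝ} (hT : 0 < T) :
    ∃ w : ℝ → UnitAddTorus (Fin 3) → EuclideanSpace ℝ (Fin 3), Torus.IsWeakPassiveVectorOn 0 T κ (W.cell n) w₀ w ∧
      ∀ᵐ t ∂(volume.restrict (Ioo 0 T)), Ψ t ≤ ∫ x, ‖w t x‖ ^ 2 := by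
  set hPV := pvSetup_cell W hn hκ.le ℓ hw₀ hdiv hmean hsupp with hPVdef
  obtain ⟨φ, c, w', hl⟩ := hPV.exists_isGalerkinLimit
  refine ⟨w', hl.isWeakPassiveVectorOn hT, ?_⟩
  filter_upwards [ae_restrict_mem measurableSet_Ioo] with t htI
  exact hl.le_integral_norm_sq_of_eventually_le_galerkin_modes htI.1.le G
    ((hl.strictMono.tendsto_atTop.eventually hΨ).mono fun N hN => hN t htI.1.le)

end Summit.AnomalousDissipation.AnomalousDissipation.Theorems.SolenoidalFractalHomogenisation.RealisedQuasiStaticCellLaw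

end
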